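import Literature.Analysis.FluidPDE.PassiveScalar
import HarnessLib

/-!
# Weak solutions of the linear transport equation with bounded divergence-free velocity:
  existence in `L^∞(0,T; L²)`, weak continuity in time, and the `L²` bound

Topic `Analysis/FluidPDE`. One named fact, `Torus.BardosTitiWiedemann2012_transportExistence`
(not proved here; discharge route recorded below), packaging the three printed sentences of the
proof of Cor. 2 of Bardos–Titi–Wiedemann, C. R. Math. Acad. Sci. Paris 350 (2012) 757–760, about
the two-dimensional transport equation `∂ₜw + u·∇w = 0`, `w(t=0) = v₃` driven by a bounded weak
Euler solution `u` (Székelyhidi's vortex-sheet solutions, `u ∈ L^∞`):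

> "Such a solution `w ∈ L^∞((0,T);L²(T²))` exists; see Proposition II.1 in [DiPerna–Lions],
> which clearly holds also in the periodic setting. Moreover, we may even assume
> `w ∈ C((0,T);L²_w(T²))`, see Appendix A of [De Lellis–Székelyhidi 2010]. Finally, as one can
> see from the proof of the cited Proposition II.1, we have `‖w(·,t)‖_{L²(T²)} ≤ ‖v₃‖_{L²(T²)}`
> for every `t > 0` (this is due to the weak lower semi-continuity of the norm in
> `L^∞((0,T);L²(T²))`)."

The sources behind it: DiPerna–Lions, Invent. Math. 98 (1989), Prop. II.1 (existence of weak
solutions `u ∈ L^∞(0,T;L^p)` of `∂ₜu - b·∇u + cu = 0`, `u(0) = u⁰ ∈ L^p`, for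
`c, div b ∈ L¹(0,T;L^∞)`, by smoothing `b`, `c`, `u⁰`, solving along characteristics and passing to
the weak limit with the a priori `L^p` bound; here `p = 2`, `c = 0`, `div b = 0`, `b` bounded);
De Lellis–Székelyhidi, Arch. Ration. Mech. Anal. 195 (2010), Lemma 7.1 (= Appendix A:
distributional solutions `v ∈ L^∞(0,T;L²)` of `∂ₜv + div u + ∇q = 0` are, after redefinition on
a null set of times, in `C((0,T);L²_w)`; the same argument with test functions supported in
`[0,T)` and the initial-datum term gives continuity on `[0,T]` with `w(0) = w₀`).

## Formal rendering

On the flat torus `T^d` (any dimension; the source uses `d = 2`), with the accepted DiPerna–Lions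
notion `Torus.IsWeakScalarTransportOn T 0 b w₀ w` of `Literature/Analysis/FluidPDE/PassiveScalar`
(`κ = 0`: measurability, `w ∈ L^∞_t L²_x`, `b ∈ L¹_t L²_x`, `bw ∈ L¹_{t,x}`, weak incompressibility
of `b(t)` for a.e. `t`, and the weak formulation `∫₀ᵀ∫ w (∂ₜφ + b·∇φ) + ∫ w₀ φ(0) = 0` for all
smooth `φ` supported in `[0,T)`), the velocity hypotheses `b ∈ L^∞((0,T) × T^d)` and
`div b(t) = 0` weakly for a.e. `t` in the form used by the accepted
`Torus.exists_isWeakScalarTransportOn` (`MemLp (stLift b) ∞`), and the conclusions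
`w ∈ C([0,T]; L²_w)` (every slice in `L²`, `t ↦ ∫ w(t) g` continuous on `[0,T]` for all
`g ∈ L²`), `‖w(t)‖₂ ≤ ‖w₀‖₂` for every `t ∈ [0,T]`, and `w(0) = w₀` (the representative may be so
normalised). Consumed by `Literature/Analysis/FluidPDE/TwoHalfWeakEuler`
(`Torus.isAdmissibleWeakEulerOn_twoHalf`) and the barrier
`Literature.Barriers.AnomalousDissipation.BardosTitiWiedemann2012_cor2`.

**Discharged**: `Torus.BardosTitiWiedemann2012_transportExistence_holds`
(`Literature/Analysis/FluidPDE/TransportWeakExistenceProofs`), by vanishing viscosity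
(DiPerna–Lions 1989, Prop. II.1: the tree's weak solutions of `∂ₜθ + b·∇θ = κΔθ`, `κ = 1/(n+1)`,
their energy bound, a weak-* limit in `L^∞(0,T;L²)`) followed by the weakly continuous
representative (De Lellis–Székelyhidi 2010, Lemma 7.1: continuous Fourier coefficient family from
the pairings with the trigonometric modes, parametrised Riesz–Fischer). The Fourier–Galerkin route
first planned here (`TransportGalerkin`, `…Scheme`, `…Limit`, `…WeakForm`, `…Existence`) proves the
case of a velocity that is moreover weakly continuous in time
(`Torus.transportExistence_of_weaklyContinuous`), which is the case met in Bardos–Titi–Wiedemann's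
proof of Cor. 2.

## References

* C. Bardos, E. S. Titi, E. Wiedemann, C. R. Math. Acad. Sci. Paris 350 (2012) 757–760, proof of
  Cor. 2 (`BardosTitiWiedemann2012`).
* R. J. DiPerna, P.-L. Lions, Invent. Math. 98 (1989) 511–547, Prop. II.1 (`DiPernaLions1989Invent`).
* C. De Lellis, L. Székelyhidi Jr., Arch. Ration. Mech. Anal. 195 (2010) 225–260, Lemma 7.1
  (Appendix A) (`DeLellisSzekelyhidi2010`).
-/

noncomputable section

open MeasureTheory Set Filter Topology Function
open scoped ENNReal InnerProductSpace

namespace Literature.Analysis.FluidPDE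

namespace Torus

/-- **Weak transport by a bounded divergence-free field: existence of a weakly continuous
solution with non-increasing `L²` norm** (Bardos–Titi–Wiedemann 2012, proof of Cor. 2, from
DiPerna–Lions 1989, Prop. II.1, and De Lellis–Székelyhidi 2010, Lemma 7.1). Let `T > 0`, let
`b : (0,T) × T^d → ℝ^d` be bounded and measurable (`b ∈ L^∞((0,T) × T^d)`) with `div b(t) = 0`
weakly for a.e. `t ∈ (0,T)`, and let `w₀ ∈ L²(T^d)`. Then there is a weak solution `w` of the
transport equation `∂ₜw + b·∇w = 0` on `T^d × [0,T)` with datum `w₀`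
(`Torus.IsWeakScalarTransportOn T 0 b w₀ w`: in particular `w ∈ L^∞(0,T;L²)` and
`∫₀ᵀ∫ w (∂ₜφ + b·∇φ) + ∫ w₀ φ(0) = 0` for all smooth `φ` supported in `[0,T)`) such that every slice
`w(t)`, `t ∈ [0,T]`, lies in `L²(T^d)` with `‖w(t)‖_{L²} ≤ ‖w₀‖_{L²}`, `t ↦ ∫ w(t) g` is continuous on
`[0,T]` for every `g ∈ L²(T^d)` (`w ∈ C([0,T];L²_w)`), and `w(0) = w₀`.
**Discharged**: `BardosTitiWiedemann2012_transportExistence_holds`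
(`Literature/Analysis/FluidPDE/TransportWeakExistenceProofs`). [cite: BardosTitiWiedemann2012, Cor. 2, proof] [cite: DiPernaLions1989Invent, Prop. II.1] [cite: DeLellisSzekelyhidi2010, Lemma 7.1] -/
def BardosTitiWiedemann2012_transportExistence (d : Type*) [Fintype d] [DecidableEq d] : Prop :=
  ∀ (T : ℝ) (_hT : 0 < T) (b : ℝ → UnitAddTorus d → EuclideanSpace ℝ d)
    (_hb : MemLp (FunctionSpaces.Torus.stLift b) ∞ (volume.restrict (Ioo 0 T ×ˢ univ)))
    (_hdiv : ∀ᵐ t ∂(volume.restrict (Ioo 0 T)), FunctionSpaces.Torus.IsWeaklyDivFree (b t))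
    (w₀ : UnitAddTorus d → ℝ) (_hw₀ : MemLp w₀ 2 volume),
    ∃ w : ℝ → UnitAddTorus d → ℝ,
      IsWeakScalarTransportOn T 0 b w₀ w ∧
      (∀ t ∈ Icc 0 T, MemLp (w t) 2 volume) ∧
      (∀ t ∈ Icc 0 T, ∫⁻ x, ‖w t x‖ₑ ^ 2 ≤ ∫⁻ x, ‖w₀ x‖ₑ ^ 2) ∧
      (∀ g : UnitAddTorus d → ℝ, MemLp g 2 volume →
        ContinuousOn (fun t => ∫ x, w t x * g x) (Icc 0 T)) ∧
      w 0 = w₀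

end Torus

end Literature.Analysis.FluidPDE

end
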